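import Summits.Ventures.PercRepro.CogirthRLS
import Summits.Ventures.PercRepro.BlockSum

/-!
# PercRepro — every block plus enough generic points is rank deficient (p9, gen 16)

`T_p(B ⊕ U_{m,m})` (a finite block `B` of rank `r` plus `m` points in general position, truncated to rank `p`) is
rank deficient at `(p, q)` as soon as `r + m ≥ p + q` (`rankDeficient_blockFree`): a non-spanning `A = X ⊔ S`
(`X ⊆ B.E`, `S ⊆ F`) has rank `ρ_B(X) + |S|`, and every `e ∈ F ∖ S` and every `e ∈ B.E ∖ cl_B(X)` raises it by
one — `m − |S|` plus at least `r − ρ_B(X)` elements. Hence **C-025 on `T_p(B ⊕ U_{m,m})` for EVERY finite block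
`B` and every `m ≥ p + q − ρ(B)`** (`rls_blockFree_of_rank_add`), by `CogirthRLS.rls_of_rankDeficient` — with no
profile table and no base-layer certificate: the line ladder (`B = U_{2,3}`, `m ≥ p + q − 2`) and the base layers of
the `K₄`, `K₄∖e`, `K₅∖e`, `K₅` families (`m ≥ p + q − 3 / 3 / 4 / 4`) are instances. Nothing about any window.
-/

namespace PercRepro.RankDist

open Set Finset Matroid PercRepro.LineLadder

variable {α : Type}

/-- The rank deficiency of `B` itself: a set `X ⊆ B.E` of rank `ρ_B(X)` has at least `ρ(B) − ρ_B(X)` elements of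
`B.E` outside its closure. -/
lemma le_ncard_compl_closure (B : Matroid α) [B.Finite] {X : Set α} (hX : X ⊆ B.E) (r : ℕ)
    (hr : B.eRank = (r : ℕ∞)) : r ≤ rk B X + (B.E \ B.closure X).ncard := by
  have h1 : B.eRank ≤ B.eRk (B.closure X ∪ (B.E \ B.closure X)) := by
    rw [← Matroid.eRk_eq_eRank (M := B) (X := B.closure X ∪ (B.E \ B.closure X))
      (fun e he => by
        by_cases h : e ∈ B.closure X
        · exact Or.inl h
        · exact Or.inr ⟨he, h⟩)]
  have h2 := B.eRk_union_le_eRk_add_encard (B.closure X) (B.E \ B.closure X)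
  rw [B.eRk_closure_eq, eRk_eq_coe_rk B hX,
    (B.ground_finite.subset Set.sdiff_subset).cast_ncard_eq.symm] at h2
  have h3 := h1.trans h2
  rw [hr] at h3
  exact_mod_cast h3

/-- **RANK DEFICIENCY OF `T_p(B ⊕ U_{m,m})`** at `(p, q)` whenever `ρ(B) + m ≥ p + q`. -/
theorem rankDeficient_blockFree (B : Matroid α) [B.Finite] {F : Set α} (hF : F.Finite)
    (hBF : Disjoint B.E (Matroid.freeOn F).E) (p q r : ℕ) (hr : B.eRank = (r : ℕ∞))
    (hm : p + q ≤ r + F.ncard) :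
    @RankDeficient α (@PercRepro.Matroid.truncate α (B.disjointSum (Matroid.freeOn F) hBF) (blockFree_finite B hF hBF) p)
      (@PercRepro.Matroid.truncate_finite α _ (blockFree_finite B hF hBF) p) p q := by
  classical
  have hBF' : Disjoint B.E F := by rwa [Matroid.freeOn_ground] at hBF
  set T := @PercRepro.Matroid.truncate α (B.disjointSum (Matroid.freeOn F) hBF) (blockFree_finite B hF hBF) p with hT
  haveI : T.Finite := @PercRepro.Matroid.truncate_finite α _ (blockFree_finite B hF hBF) p
  have hTE : T.E = B.E ∪ F := by
    rw [hT, PercRepro.Matroid.truncate_ground, Matroid.disjointSum_ground_eq, Matroid.freeOn_ground]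
  intro A hA hlt
  show p + q ≤ rk T A + (extSet T A).card
  rw [hTE] at hA
  have hX : A ∩ B.E ⊆ B.E := inter_subset_right
  have hS : A ∩ F ⊆ F := inter_subset_right
  have hrkA : T.eRk A = min (B.eRk (A ∩ B.E) + ((A ∩ F).ncard : ℕ∞)) p := blockFree_eRk B hF hBF p hA
  rw [eRk_eq_coe_rk B hX] at hrkA
  -- the untruncated rank
  have hlt' : rk B (A ∩ B.E) + (A ∩ F).ncard < p := by
    rw [hrkA, min_lt_iff] at hlt
    rcases hlt with h | h
    · exact_mod_cast h
    · exact absurd h (lt_irrefl _)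
  have hrkA' : T.eRk A = ((rk B (A ∩ B.E) + (A ∩ F).ncard : ℕ) : ℕ∞) := by
    rw [hrkA, Nat.cast_add, min_eq_left]
    exact_mod_cast hlt'.le
  have hrkT : rk T A = rk B (A ∩ B.E) + (A ∩ F).ncard := by
    rw [rk, hrkA', ENat.toNat_coe]
  -- the two families of rank-increasing elements
  have hext1 : ∀ e ∈ F \ A, e ∈ extSet T A := by
    intro e he
    rw [mem_extSet, hTE]
    refine ⟨Or.inr he.1, ?_⟩
    have heB : e ∉ B.E := fun h => hBF'.notMem_of_mem_left h he.1
    have hiA : insert e A ⊆ B.E ∪ F := Set.insert_subset (Or.inr he.1) hA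
    rw [blockFree_eRk B hF hBF p hiA, Set.insert_inter_of_notMem heB, Set.insert_inter_of_mem he.1,
      Set.ncard_insert_of_notMem (fun h => he.2 h.1) (hF.subset hS), eRk_eq_coe_rk B hX, hrkA']
    push_cast
    rw [min_eq_left]
    · ring
    · exact_mod_cast (show rk B (A ∩ B.E) + ((A ∩ F).ncard + 1) ≤ p by omega)
  have hext2 : ∀ e ∈ B.E \ B.closure (A ∩ B.E), e ∈ extSet T A := by
    intro e he
    rw [mem_extSet, hTE]
    refine ⟨Or.inl he.1, ?_⟩
    have heF : e ∉ F := fun h => hBF'.notMem_of_mem_right h he.1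
    have hiA : insert e A ⊆ B.E ∪ F := Set.insert_subset (Or.inl he.1) hA
    rw [blockFree_eRk B hF hBF p hiA, Set.insert_inter_of_mem he.1, Set.insert_inter_of_notMem heF,
      Matroid.eRk_insert_eq_add_one he, eRk_eq_coe_rk B hX, hrkA']
    push_cast
    rw [min_eq_left]
    · ring
    · exact_mod_cast (show rk B (A ∩ B.E) + 1 + (A ∩ F).ncard ≤ p by omega)
  -- count them
  have hdisj : Disjoint (F \ A) (B.E \ B.closure (A ∩ B.E)) :=
    (hBF'.symm.mono_left Set.sdiff_subset).mono_right Set.sdiff_subset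
  have hsub : (F \ A) ∪ (B.E \ B.closure (A ∩ B.E)) ⊆ ↑(extSet T A) := by
    intro e he
    rw [Finset.mem_coe]
    rcases he with h | h
    · exact hext1 e h
    · exact hext2 e h
  have hfin1 : (F \ A).Finite := hF.subset Set.sdiff_subset
  have hfin2 : (B.E \ B.closure (A ∩ B.E)).Finite := B.ground_finite.subset Set.sdiff_subset
  have hcard := Set.ncard_le_ncard hsub (Finset.finite_toSet _)
  rw [Set.ncard_coe_finset, Set.ncard_union_eq hdisj hfin1 hfin2] at hcard
  have hFA : (F \ A).ncard = F.ncard - (A ∩ F).ncard := by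
    rw [show F \ A = F \ (A ∩ F) by ext e; simp only [Set.mem_sdiff, mem_inter_iff]; tauto]
    exact Set.ncard_sdiff hS (hF.subset hS)
  have hSF : (A ∩ F).ncard ≤ F.ncard := Set.ncard_le_ncard hS hF
  have hB := le_ncard_compl_closure B hX r hr
  rw [hrkT]
  omega

/-- **C-025 ON `T_p(B ⊕ U_{m,m})` FOR EVERY FINITE BLOCK `B` AND EVERY `m ≥ p + q − ρ(B)`**: `ThmN.RLS` at
`(p, q)` on the block `B` plus `|F|` points in general position, truncated to rank `p`, whenever
`ρ(B) + |F| ≥ p + q` — the base layer `m₀ = p + q − ρ(B)` of every block family and everything above it, by the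
cogirth criterion alone. -/
theorem rls_blockFree_of_rank_add (B : Matroid α) [B.Finite] {F : Set α} (hF : F.Finite)
    (hBF : Disjoint B.E (Matroid.freeOn F).E) (p q r : ℕ) (hr : B.eRank = (r : ℕ∞))
    (hm : p + q ≤ r + F.ncard) :
    @ThmN.RLS α (@PercRepro.Matroid.truncate α (B.disjointSum (Matroid.freeOn F) hBF) (blockFree_finite B hF hBF) p)
      (@PercRepro.Matroid.truncate_finite α _ (blockFree_finite B hF hBF) p) p q :=
  rls_of_rankDeficient _ p q (rankDeficient_blockFree B hF hBF p q r hr hm)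

end PercRepro.RankDist
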